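import Mathlib
import HarnessLib
import Literature.MathematicalPhysics.QuantumLattice.GaugeGroups
import Literature.LinearAlgebra.Matrix.UnitaryGroupMaximalTorus
import Literature.LinearAlgebra.Matrix.SpecialUnitaryGroupConjugacyClasses
import Summits.Ventures.LatticeQCDFlow.Exactness.FlowPushforward
import Summits.Ventures.LatticeQCDFlow.Exactness.SpectralKernelJacobianWeylShapeSU
import Summits.Ventures.LatticeQCDFlow.Exactness.TorusCircleChart

/-!
# Weyl symmetry of the torus `SΔ(n)`: permuting the eigen-phases preserves Haar, and a Jacobian certified on one chamber of a symmetric decomposition is a Jacobian for the whole measure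

HONEST FRAMING: exact (Metropolis-corrected) sampling algorithms for lattice gauge theory;
figures of merit are autocorrelation/cost numbers at stated couplings and volumes; no
continuum-physics claim.

Venture `LatticeQCDFlow` (cell pub-lqcd), topic `Exactness`; FANOUT row 10 (`eng-equiv`, engine
`latflow.equiv` `spectral.py` Algorithm 1: `canonicalise` sorts the eigen-phases into the cell and
REMEMBERS THE PERMUTATION; `uncanonicalise` applies it back — the kernel's torus map is
Weyl-equivariant and is given by the cell flow on ONE chamber).  NEW WORK of the cell over this row's
`TorusCircleChart.lean` (`hasJacobian_of_presentation`, `HasJacobian.add`,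
`map_eq_haarProbability_of_mul_of_surjective`).  Nothing is cited as a fact; no number; no definition
(the permutation maps enter through a characterising hypothesis `hP` and an existence theorem).
Step 2a of 3 towards the `N ≥ 3` alcove (after `TorusCubeChart.lean`, `TorusWallsNull.lean`).

## What is typed

* `HasJacobian.zero_measure`, **`HasJacobian.finset_sum`** — Jacobians for finite sums of reference
  measures;
* **`hasJacobian_of_symmetric_pieces`** — if `vol = Σ_σ (P σ)_* (vol|C)` for finitely many measurable
  symmetries `P σ` and a piece `C` (a fundamental domain up to null sets), `F` commutes with every
  `P σ` and `J` is `P σ`-invariant, then `HasJacobian (vol|C) F J ⟹ HasJacobian vol F J`: a flow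
  certified on ONE Weyl chamber and extended equivariantly is certified everywhere;
* `diagonal_perm_mem_specialUnitaryGroup`, **`exists_permDiag_specialDiagonalTorus`** (the phase
  permutation `t ↦ diag(t_{σσ})` of `SΔ(n)` exists, continuous), `permDiag_mul`,
  `permDiag_surjective_continuous`, **`map_permDiag_haar_specialDiagonalTorus`** — it preserves
  `Haar_{SΔ(n)}` (a continuous surjective homomorphism of the compact group onto itself).

NOT here: that the `n!` chambers `σ · E(Ψ°)` form such a decomposition of `Haar_{SΔ(n)}` (step 2b: the
alcove is a fundamental domain) and the simplex cell map (step 3); any number.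
-/

noncomputable section

namespace Summit.Ventures.LatticeQCDFlow.Exactness

open MeasureTheory Matrix Topology Set
open Literature.LinearAlgebra.Matrix
open Literature.MathematicalPhysics.QuantumFieldTheory (haarProbability)
open scoped ENNReal

/-! ## Jacobians for finite sums of reference measures; symmetric pieces -/

section Pieces

variable {Ω : Type*} [MeasurableSpace Ω]

/-- The zero measure: any measurable pair is a Jacobian pair. -/
theorem HasJacobian.zero_measure {F : Ω → Ω} (hF : Measurable F) {J : Ω → ℝ≥0∞} (hJ : Measurable J) :
    HasJacobian (0 : Measure Ω) F J where
  measurable := hF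
  measurable_jac := hJ
  map_eq := by rw [withDensity_zero_left, Measure.map_zero]

/-- **Finite sums of reference measures**: `HasJacobian (μ σ) F J` for every `σ ∈ s` gives
`HasJacobian (Σ_{σ ∈ s} μ σ) F J`. -/
theorem HasJacobian.finset_sum {G : Type*} (s : Finset G) {μ : G → Measure Ω} {F : Ω → Ω}
    (hF : Measurable F) {J : Ω → ℝ≥0∞} (hJ : Measurable J) (h : ∀ σ ∈ s, HasJacobian (μ σ) F J) :
    HasJacobian (∑ σ ∈ s, μ σ) F J := by
  classical
  induction s using Finset.induction_on with
  | empty => simpa using HasJacobian.zero_measure hF hJ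
  | insert a s ha ih =>
    rw [Finset.sum_insert ha]
    exact (h a (Finset.mem_insert_self a s)).add (ih fun σ hσ => h σ (Finset.mem_insert_of_mem hσ))

/-- **A Jacobian certified on one piece of a symmetric decomposition is a Jacobian for the whole
measure.**  Let `P σ` (`σ` in a finite type) be measurable maps with `vol = Σ_σ (P σ)_* (vol|C)`
(e.g. the Weyl images of one chamber, the walls being null), let `F` commute with every `P σ` and
`J` be `P σ`-invariant.  If `F` has Jacobian `J` for `vol|C`, then for `vol`. -/
theorem hasJacobian_of_symmetric_pieces {G : Type*} [Fintype G] {vol : Measure Ω} {P : G → Ω → Ω}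
    (hP : ∀ σ, Measurable (P σ)) {C : Set Ω}
    (hdecomp : vol = ∑ σ, Measure.map (P σ) (vol.restrict C))
    {F : Ω → Ω} (hF : Measurable F) {J : Ω → ℝ≥0∞} (hJ : Measurable J)
    (hFC : HasJacobian (vol.restrict C) F J) (hcomm : ∀ σ x, F (P σ x) = P σ (F x))
    (hJinv : ∀ σ x, J (P σ x) = J x) : HasJacobian vol F J := by
  rw [hdecomp]
  exact HasJacobian.finset_sum _ hF hJ fun σ _ =>
    hasJacobian_of_presentation (hP σ) rfl hFC hF hJ (hcomm σ) (hJinv σ)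

end Pieces

/-! ## The phase permutations of `SΔ(n)` preserve Haar -/

section Perm

variable {n : Type*} [Fintype n] [DecidableEq n] (σ : Equiv.Perm n)

/-- A permuted diagonal of `SΔ(n)` is again in `SU(n)`. -/
theorem diagonal_perm_mem_specialUnitaryGroup (t : specialDiagonalTorus n) :
    diagonal (fun i => ((t : Matrix.specialUnitaryGroup n ℂ) : Matrix n n ℂ) (σ i) (σ i)) ∈
      Matrix.specialUnitaryGroup n ℂ := by
  obtain ⟨hd, hprod⟩ := norm_eq_one_and_prod_eq_one_of_mem_specialDiagonalTorus
    (coe_specialDiagonalTorus_eq_diagonal t)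
  refine (Literature.MathematicalPhysics.QuantumLattice.diagonal_mem_specialUnitaryGroup_iff _).mpr
    ⟨fun i => hd (σ i), ?_⟩
  rw [Equiv.prod_comp σ (fun i => ((t : Matrix.specialUnitaryGroup n ℂ) : Matrix n n ℂ) i i)]
  exact hprod

/-- **The phase permutation `t ↦ diag(t_{σ(i)σ(i)})` of `SΔ(n)` exists and is continuous.** -/
theorem exists_permDiag_specialDiagonalTorus :
    ∃ P : specialDiagonalTorus n → specialDiagonalTorus n, Continuous P ∧
      ∀ t i, (((P t : specialDiagonalTorus n) : Matrix.specialUnitaryGroup n ℂ) : Matrix n n ℂ) i i =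
        ((t : Matrix.specialUnitaryGroup n ℂ) : Matrix n n ℂ) (σ i) (σ i) := by
  refine ⟨fun t => ⟨⟨diagonal (fun i => ((t : Matrix.specialUnitaryGroup n ℂ) : Matrix n n ℂ) (σ i) (σ i)),
    diagonal_perm_mem_specialUnitaryGroup σ t⟩, ⟨_, rfl⟩⟩, ?_, fun t i => ?_⟩
  · refine continuous_induced_rng.2 (continuous_induced_rng.2 ?_)
    change Continuous fun t : specialDiagonalTorus n =>
      diagonal (fun i => ((t : Matrix.specialUnitaryGroup n ℂ) : Matrix n n ℂ) (σ i) (σ i))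
    exact (continuous_pi fun i => (continuous_apply (σ i)).comp ((continuous_apply (σ i)).comp
      (continuous_subtype_val.comp continuous_subtype_val))).matrix_diagonal
  · change (diagonal (fun i => ((t : Matrix.specialUnitaryGroup n ℂ) : Matrix n n ℂ) (σ i) (σ i))) i i = _
    rw [diagonal_apply_eq]

variable {σ} {P : specialDiagonalTorus n → specialDiagonalTorus n}
  (hP : ∀ t i, (((P t : specialDiagonalTorus n) : Matrix.specialUnitaryGroup n ℂ) : Matrix n n ℂ) i i =
    ((t : Matrix.specialUnitaryGroup n ℂ) : Matrix n n ℂ) (σ i) (σ i))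

include hP

/-- The matrix of `P t` is the permuted diagonal. -/
theorem coe_permDiag (t : specialDiagonalTorus n) :
    (((P t : specialDiagonalTorus n) : Matrix.specialUnitaryGroup n ℂ) : Matrix n n ℂ) =
      diagonal (fun i => ((t : Matrix.specialUnitaryGroup n ℂ) : Matrix n n ℂ) (σ i) (σ i)) := by
  rw [coe_specialDiagonalTorus_eq_diagonal (P t)]
  exact congrArg diagonal (funext fun i => hP t i)

/-- The phase permutation is multiplicative. -/
theorem permDiag_mul (s t : specialDiagonalTorus n) : P (s * t) = P s * P t := by
  apply Subtype.ext
  apply Subtype.ext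
  have hst : (((s * t : specialDiagonalTorus n) : Matrix.specialUnitaryGroup n ℂ) : Matrix n n ℂ) =
      ((s : Matrix.specialUnitaryGroup n ℂ) : Matrix n n ℂ) * ((t : Matrix.specialUnitaryGroup n ℂ) : Matrix n n ℂ) :=
    rfl
  have hPst : (((P s * P t : specialDiagonalTorus n) : Matrix.specialUnitaryGroup n ℂ) : Matrix n n ℂ) =
      (((P s : specialDiagonalTorus n) : Matrix.specialUnitaryGroup n ℂ) : Matrix n n ℂ) *
        (((P t : specialDiagonalTorus n) : Matrix.specialUnitaryGroup n ℂ) : Matrix n n ℂ) := rfl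
  rw [hPst, coe_permDiag hP, coe_permDiag hP, coe_permDiag hP, diagonal_mul_diagonal]
  refine congrArg diagonal (funext fun i => ?_)
  rw [hst]
  conv_lhs => rw [coe_specialDiagonalTorus_eq_diagonal s, coe_specialDiagonalTorus_eq_diagonal t,
    diagonal_mul_diagonal, diagonal_apply_eq]

/-- **The phase permutation is a continuous surjection of `SΔ(n)` onto itself** (`diag(s ∘ σ⁻¹) ↦ s`). -/
theorem permDiag_surjective_continuous : Function.Surjective P ∧ Continuous P := by
  refine ⟨fun s => ?_, ?_⟩
  · refine ⟨⟨⟨diagonal (fun i => ((s : Matrix.specialUnitaryGroup n ℂ) : Matrix n n ℂ) (σ⁻¹ i) (σ⁻¹ i)),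
      diagonal_perm_mem_specialUnitaryGroup σ⁻¹ s⟩, ⟨_, rfl⟩⟩, ?_⟩
    apply Subtype.ext
    apply Subtype.ext
    rw [coe_permDiag hP]
    conv_rhs => rw [coe_specialDiagonalTorus_eq_diagonal s]
    refine congrArg diagonal (funext fun i => ?_)
    change (diagonal (fun i => ((s : Matrix.specialUnitaryGroup n ℂ) : Matrix n n ℂ) (σ⁻¹ i) (σ⁻¹ i))) (σ i) (σ i) = _
    rw [diagonal_apply_eq, Equiv.Perm.inv_def, Equiv.symm_apply_apply]
  · refine continuous_induced_rng.2 (continuous_induced_rng.2 ?_)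
    have hfun : (fun t => (((P t : specialDiagonalTorus n) : Matrix.specialUnitaryGroup n ℂ) : Matrix n n ℂ)) =
        fun t : specialDiagonalTorus n =>
          diagonal (fun i => ((t : Matrix.specialUnitaryGroup n ℂ) : Matrix n n ℂ) (σ i) (σ i)) :=
      funext fun t => coe_permDiag hP t
    change Continuous fun t => (((P t : specialDiagonalTorus n) : Matrix.specialUnitaryGroup n ℂ) : Matrix n n ℂ)
    rw [hfun]
    exact (continuous_pi fun i => (continuous_apply (σ i)).comp ((continuous_apply (σ i)).comp
      (continuous_subtype_val.comp continuous_subtype_val))).matrix_diagonal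

/-- **Permuting the eigen-phases preserves `Haar_{SΔ(n)}`** (a continuous surjective homomorphism of
the compact group onto itself presents its Haar probability). -/
theorem map_permDiag_haar_specialDiagonalTorus :
    Measure.map P (haarProbability (specialDiagonalTorus n)) = haarProbability (specialDiagonalTorus n) := by
  haveI : SecondCountableTopology (specialDiagonalTorus n) := secondCountableTopology_specialDiagonalTorus
  exact map_eq_haarProbability_of_mul_of_surjective _ (permDiag_surjective_continuous hP).2.measurable
    (permDiag_mul hP) (permDiag_surjective_continuous hP).1

end Perm

/-! ## Appendix (GEN 8, append-only): symmetric pieces presented by an arbitrary piece measure -/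

section PiecesGeneral

variable {Ω : Type*} [MeasurableSpace Ω]

/-- **Symmetric pieces, general piece measure.**  As `hasJacobian_of_symmetric_pieces`, but the piece
may be ANY measure `ν` with `vol = Σ_σ (P σ)_* ν` (e.g. `ν = c · E_*(Leb|_A)` for the alcove `A` pushed
through the angle chart `E` — no measurability of the chamber `E(A)` is needed): if `F` has Jacobian
`J` for `ν`, commutes with every `P σ` and `J` is `P σ`-invariant, then `F` has Jacobian `J` for `vol`. -/
theorem hasJacobian_of_symmetric_pieces' {G : Type*} [Fintype G] {vol ν : Measure Ω} {P : G → Ω → Ω}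
    (hP : ∀ σ, Measurable (P σ)) (hdecomp : vol = ∑ σ, Measure.map (P σ) ν)
    {F : Ω → Ω} (hF : Measurable F) {J : Ω → ℝ≥0∞} (hJ : Measurable J)
    (hFν : HasJacobian ν F J) (hcomm : ∀ σ x, F (P σ x) = P σ (F x))
    (hJinv : ∀ σ x, J (P σ x) = J x) : HasJacobian vol F J := by
  rw [hdecomp]
  exact HasJacobian.finset_sum _ hF hJ fun σ _ =>
    hasJacobian_of_presentation (hP σ) rfl hFν hF hJ (hcomm σ) (hJinv σ)

end PiecesGeneral

end Summit.Ventures.LatticeQCDFlow.Exactness
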